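import Literature.NumberTheory.DiophantineGeometry.BelyiWitnessExistence
import Literature.NumberTheory.DiophantineGeometry.BelyiWitnessChart
import Literature.NumberTheory.DiophantineGeometry.AbcWave0
import HarnessLib

/-!
# Belyi's polynomial `β_{a,b} = (a+b)^{a+b} x^a (1−x)^b / (a^a b^b)`: `deg_B(ℙ¹; 0,1,∞, a/(a+b)) ≤ a + b`,
# and the reverse chart change `HasBelyiWitness ↔ cross-ratio normal form`

Topic `NumberTheory/DiophantineGeometry`; proof-only companion of `BelyiDegree.lean` (witness predicate
`HasBelyiWitness d t`, `belyiDegree t`), `BelyiWitnessExistence.lean` (`hasBelyiWitness_of_polynomial`) and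
`BelyiWitnessChart.lean` (`HasBelyiWitness.of_crossRatio`). Theorems only; no definition, no named fact.

`BelyiDegree.lean` records as NOT proved there: "for `t = a/c ∈ ℚ ∩ (0,1)` Belyi's map
`c^c x^a (1−x)^b / (a^a b^b)` gives `belyiDegree (a/c) ≤ c`" (Belyĭ 1980, second proof of his theorem;
Khadjavi 2002 §1; the support items `BelyiTrivialBound` / `BelyiWitnessLeC` of the closed routes
ABC/BelyiDegreeSmooth, ABC/BelyiSqueeze, both «provable now», never landed). This file proves it:

* `hasBelyiWitness_belyiPolynomial` — for `a, b ≥ 1`, the polynomial `β_{a,b} = K·X^a·(1−X)^b`,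
  `K = (a+b)^{a+b}/(a^a b^b)`, has `β(0) = β(1) = 0`, `β(a/(a+b)) = 1`, and its finite critical points are
  `0` (if `a ≥ 2`), `1` (if `b ≥ 2`) and `a/(a+b)` (`β' = K·X^{a−1}(1−X)^{b−1}·(a − (a+b)X)`), so all finite
  critical VALUES lie in `{0, 1}`; by `hasBelyiWitness_of_polynomial` (Riemann–Hurwitz / Mason–Stothers
  equality count) it is a witness: **`HasBelyiWitness (a + b) (a/(a+b))`**;
* `IsABCTriple.hasBelyiWitness`, `IsABCTriple.belyiDegree_le` — for an abc triple `a + b = c`: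
  `HasBelyiWitness c (a/c)` and **`belyiDegree (a/c) ≤ c`**; `IsABCTriple.exists_hasBelyiWitness` discharges
  the binder `hex : ∃ d, HasBelyiWitness d (a/c)` of `BelyiDegreeBadPrimes.IsABCTriple.prime_le_belyiDegree`;
* `BelyiWitness.exists_crossRatio_of_inftyChart` — the REVERSE chart change (public form of the argument
  used privately in `Summits/ABC/ABC/Theorems/BelyiSqueezeDegBelyiLowerRefutation.lean`): a witness in the
  `∞`-chart (`max (deg p) (deg q) = n`, a degree drop, `n + 1` affine special points) with three distinct
  affine special points `y, z, w` yields a witness in the cross-ratio normal form of route ABC/BelyiSqueeze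
  (`deg P = deg Q = deg (P − Q) = n`, `n + 2` special points, four marked ones of cross-ratio
  `(y − z)/(w − z)`): substitute `u ↦ u⁻¹ + t₀` for a non-special `t₀`;
* `HasBelyiWitness.exists_crossRatio`, `hasBelyiWitness_iff_exists_crossRatio` — hence for `t ∉ {0, 1}`
  the two inlined witness predicates of the two routes are EQUIVALENT
  (`HasBelyiWitness n t ↔ ∃` cross-ratio-`t` normal form of degree `n`);
* `IsABCTriple.exists_crossRatio_witness` — Belyi's polynomial in the cross-ratio normal form: every abc
  triple has a degree-`c` witness with four marked special points of cross-ratio `a/c` (the content of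
  route item `BelyiWitnessLeC`, stated in Literature vocabulary).

Cell abc-iut, FACT-LIST row F-2686 (`DegBelyiRadical`; the list's locator «[GenEll] Thm 3.2» is a tag
erratum — the decl is crux 3 of the closed route ABC/BelyiSqueeze, an abc-implied CONJECTURE, see
`Summits/ABC/ABC/Theorems/BelyiSqueezeDegBelyiRadicalOfABC.lean`); seat abc-iut-f-135 (gen 6).

## References

* G. V. Belyĭ, *On Galois extensions of a maximal cyclotomic field*, Math. USSR Izv. 14 (1980) 247–256,
  §3 (the polynomial `x^a (1−x)^b` normalised). [Belyi1980]
* L. S. Khadjavi, *An effective version of Belyi's theorem*, J. Number Theory 96 (2002) 22–47, §1.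
  [Khadjavi2002]
-/

noncomputable section

namespace Literature.NumberTheory.DiophantineGeometry

open Polynomial
open Literature.NumberTheory.DiophantineGeometry.BelyiWitness

/-! ## Belyi's polynomial -/

/-- **Belyi's polynomial is a Belyi witness** (Belyĭ 1980): for `a = a' + 1 ≥ 1`, `b = b' + 1 ≥ 1` the
polynomial `β = K·X^a·(1−X)^b` with `K = (a+b)^{a+b}/(a^a·b^b)` satisfies `β(0) = β(1) = 0`,
`β(a/(a+b)) = 1`, and `β'(z) = K·z^{a'}·(1−z)^{b'}·(a(1−z) − b z)` vanishes only at `z ∈ {0, 1, a/(a+b)}`,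
where `β ∈ {0, 1}`; hence (`hasBelyiWitness_of_polynomial`) `HasBelyiWitness (a + b) (a/(a+b))`.
[cite: Belyi1980, §3] -/
theorem hasBelyiWitness_belyiPolynomial {a b : ℕ} (ha : 0 < a) (hb : 0 < b) :
    HasBelyiWitness (a + b) ((a : ℂ) / ((a : ℂ) + (b : ℂ))) := by
  obtain ⟨a', rfl⟩ := Nat.exists_eq_succ_of_ne_zero ha.ne'
  obtain ⟨b', rfl⟩ := Nat.exists_eq_succ_of_ne_zero hb.ne'
  simp only [Nat.succ_eq_add_one] at *
  -- abbreviations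
  set A : ℂ := ((a' + 1 : ℕ) : ℂ) with hA
  set B : ℂ := ((b' + 1 : ℕ) : ℂ) with hB
  have hA0 : A ≠ 0 := by rw [hA]; exact_mod_cast Nat.succ_ne_zero a'
  have hB0 : B ≠ 0 := by rw [hB]; exact_mod_cast Nat.succ_ne_zero b'
  have hApos : 0 < A.re := by rw [hA]; simp; positivity
  have hBpos : 0 < B.re := by rw [hB]; simp; positivity
  have hAB0 : A + B ≠ 0 := by
    intro h
    have := congrArg Complex.re h
    simp only [Complex.add_re, Complex.zero_re] at this
    linarith
  set K : ℂ := (A + B) ^ (a' + 1 + (b' + 1)) / (A ^ (a' + 1) * B ^ (b' + 1)) with hK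
  have hK0 : K ≠ 0 := by
    rw [hK]
    exact div_ne_zero (pow_ne_zero _ hAB0) (mul_ne_zero (pow_ne_zero _ hA0) (pow_ne_zero _ hB0))
  set p : ℂ[X] := C K * (X ^ (a' + 1) * (1 - X) ^ (b' + 1)) with hp
  -- degree
  have h1X : (1 - X : ℂ[X]) = -(X - C 1) := by rw [map_one]; ring
  have h1Xdeg : (1 - X : ℂ[X]).natDegree = 1 := by rw [h1X, natDegree_neg, natDegree_X_sub_C]
  have h1X0 : (1 - X : ℂ[X]) ≠ 0 := fun h => by rw [h, natDegree_zero] at h1Xdeg; exact zero_ne_one h1Xdeg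
  have hdeg : p.natDegree = a' + 1 + (b' + 1) := by
    rw [hp, natDegree_C_mul hK0, natDegree_mul (pow_ne_zero _ X_ne_zero) (pow_ne_zero _ h1X0),
      natDegree_pow, natDegree_pow, natDegree_X, h1Xdeg, mul_one, mul_one]
  -- values
  have hev : ∀ z : ℂ, p.eval z = K * (z ^ (a' + 1) * (1 - z) ^ (b' + 1)) := fun z => by
    simp only [hp, eval_mul, eval_C, eval_pow, eval_X, eval_sub, eval_one]
  have h0 : p.eval 0 = 0 := by rw [hev]; simp
  have h1 : p.eval 1 = 0 := by rw [hev]; simp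
  set t : ℂ := A / (A + B) with ht
  have h1t : 1 - t = B / (A + B) := by rw [ht]; field_simp; ring
  have hpt : p.eval t = 1 := by
    rw [hev, h1t, ht, hK, div_pow, div_pow]
    field_simp
    ring
  -- derivative
  have hder : ∀ z : ℂ, (derivative p).eval z =
      K * (z ^ a' * (1 - z) ^ b') * ((A : ℂ) * (1 - z) - B * z) := fun z => by
    have hd : derivative p = C K * (C ((a' + 1 : ℕ) : ℂ) * X ^ a' * (1 - X) ^ (b' + 1) +
        X ^ (a' + 1) * (C ((b' + 1 : ℕ) : ℂ) * (1 - X) ^ b' * (0 - 1))) := by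
      rw [hp, derivative_C_mul, derivative_mul, derivative_X_pow, derivative_pow, derivative_sub,
        derivative_one, derivative_X]
      simp only [Nat.add_sub_cancel]
    rw [hd]
    simp only [eval_mul, eval_add, eval_C, eval_pow, eval_X, eval_sub, eval_one, eval_zero, ← hA, ← hB]
    ring
  have hcrit : ∀ z : ℂ, (derivative p).eval z = 0 → p.eval z = 0 ∨ p.eval z = 1 := by
    intro z hz
    rw [hder] at hz
    rcases mul_eq_zero.mp hz with hz | hz
    · rcases mul_eq_zero.mp hz with hz | hz
      · exact absurd hz hK0
      · rcases mul_eq_zero.mp hz with hz | hz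
        · left; rw [hev, pow_succ, pow_eq_zero_iff'.mp hz |>.1]; simp
        · left
          have h1z : 1 - z = 0 := (pow_eq_zero_iff'.mp hz).1
          rw [hev, h1z]; simp
    · right
      have hz' : z = t := by
        rw [ht, eq_div_iff hAB0]
        linear_combination -hz
      rw [hz', hpt]
  have hw := hasBelyiWitness_of_polynomial (p := p) (by rw [hdeg]; omega) hcrit (t := t)
    (Or.inl h0) (Or.inl h1) (Or.inr hpt)
  rw [hdeg] at hw
  have htcast : t = (((a' + 1 : ℕ) : ℂ) / (((a' + 1 : ℕ) : ℂ) + ((b' + 1 : ℕ) : ℂ))) := by rw [ht, hA, hB]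
  rw [htcast] at hw
  exact hw

/-- **`deg_B(a/c) ≤ c` for abc triples, witness form**: an abc triple `a + b = c` carries Belyi's
polynomial witness of degree `c`: `HasBelyiWitness c (a/c)`. [cite: Belyi1980, §3] -/
theorem IsABCTriple.hasBelyiWitness {a b c : ℕ} (h : IsABCTriple a b c) :
    HasBelyiWitness c ((a : ℂ) / (c : ℂ)) := by
  obtain ⟨ha, hb, rfl, -⟩ := h
  rw [Nat.cast_add]
  exact hasBelyiWitness_belyiPolynomial ha hb

/-- Binder discharge: for an abc triple the four-pointed line `(ℙ¹; 0,1,∞,a/c)` HAS a Belyi witness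
(the hypothesis `hex` of `BelyiDegreeBadPrimes.IsABCTriple.prime_le_belyiDegree`). [cite: Belyi1980, §3] -/
theorem IsABCTriple.exists_hasBelyiWitness {a b c : ℕ} (h : IsABCTriple a b c) :
    ∃ d, HasBelyiWitness d ((a : ℂ) / (c : ℂ)) :=
  ⟨c, h.hasBelyiWitness⟩

/-- **Belyi's bound `deg_B(ℙ¹; 0, 1, ∞, a/c) ≤ c`** for every abc triple `a + b = c` (Belyĭ 1980; the
sentence `BelyiDegree.lean` records as "not proved here"). [cite: Belyi1980, §3] -/
theorem IsABCTriple.belyiDegree_le {a b c : ℕ} (h : IsABCTriple a b c) :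
    belyiDegree ((a : ℂ) / (c : ℂ)) ≤ c :=
  Literature.NumberTheory.DiophantineGeometry.belyiDegree_le h.hasBelyiWitness

/-- Hence `1 ≤ deg_B(a/c) ≤ c` for abc triples. [cite: Belyi1980, §3] -/
theorem IsABCTriple.belyiDegree_pos {a b c : ℕ} (h : IsABCTriple a b c) :
    0 < belyiDegree ((a : ℂ) / (c : ℂ)) :=
  Literature.NumberTheory.DiophantineGeometry.belyiDegree_pos h.exists_hasBelyiWitness

/-! ## The reverse chart change: from the `∞`-chart to the cross-ratio normal form -/

namespace BelyiWitness

/-- **Reverse chart change** (`∞`-chart → cross-ratio normal form). Coprime `p, q` with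
`max (deg p) (deg q) = n`, a degree drop among `p, q, p − q` (`∞` special), `n + 1` affine special points,
three of them `y, z, w` distinct, give a witness in the normal form of route ABC/BelyiSqueeze —
`deg P = deg Q = deg (P − Q) = n`, `n + 2` special points, four marked ones `x', y', z', w'` — with
cross-ratio `(y − z)/(w − z) = CR(∞, y; z, w)`: substitute `u ↦ u⁻¹ + t₀` for a non-special `t₀`
(translate by `taylor t₀`, then `reflect n`). Public form of the argument used (privately) by the refuter of
`BelyiSqueeze.DegBelyiLower` (`Summits/ABC/ABC/Theorems/BelyiSqueezeDegBelyiLowerRefutation.lean`);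
converse of `BelyiWitness.toInftyChart`. The Belyi degree of a pointed line is invariant under automorphisms
of `ℙ¹` (the normal forms differ by a Möbius change of source coordinate).
[cite: Zapponi2009BelyiDegree, §1.1] [cite: Goldring2011, Thm 3.2] -/
theorem exists_crossRatio_of_inftyChart {n : ℕ} {p q : ℂ[X]} {y z w : ℂ}
    (hcop : IsCoprime p q) (hmax : max p.natDegree q.natDegree = n)
    (hdrop : p.natDegree < n ∨ q.natDegree < n ∨ (p - q).natDegree < n)
    (hcard : (p * q * (p - q)).roots.toFinset.card = n + 1)
    (hyz : y ≠ z) (hyw : y ≠ w) (hzw : z ≠ w)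
    (hy : (p * q * (p - q)).eval y = 0) (hz : (p * q * (p - q)).eval z = 0)
    (hw : (p * q * (p - q)).eval w = 0) :
    ∃ (P Q : ℂ[X]) (x' y' z' w' : ℂ), IsCoprime P Q ∧ P.natDegree = n ∧ Q.natDegree = n ∧
      (P - Q).natDegree = n ∧ (P * Q * (P - Q)).roots.toFinset.card = n + 2 ∧
      ({x', y', z', w'} : Finset ℂ).card = 4 ∧
      {x', y', z', w'} ⊆ (P * Q * (P - Q)).roots.toFinset ∧
      (w' - x') * (y' - z') = (y - z) / (w - z) * ((w' - z') * (y' - x')) := by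
  -- adapted from Summits/ABC/ABC/Theorems/BelyiSqueezeDegBelyiLowerRefutation.lean (private
  -- `BelyiSqueeze.exists_crossRatio_chart`, refuter seat rreview-route-ABC-BelyiSqueeze-r-ee9464b7)
  classical
  obtain ⟨R, hR⟩ : ∃ R, R = p * q * (p - q) := ⟨_, rfl⟩
  rw [← hR] at hcard hy hz hw
  have hR0 : R ≠ 0 := by
    intro h; rw [h, roots_zero, Multiset.toFinset_zero, Finset.card_empty] at hcard; omega
  have hp0 : p ≠ 0 := fun h => hR0 (by rw [hR, h, zero_mul, zero_mul])
  have hq0 : q ≠ 0 := fun h => hR0 (by rw [hR, h, mul_zero, zero_mul])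
  have hn : 0 < n := by rcases hdrop with h | h | h <;> exact Nat.lt_of_le_of_lt (Nat.zero_le _) h
  have hp : p.natDegree ≤ n := hmax ▸ le_max_left _ _
  have hq : q.natDegree ≤ n := hmax ▸ le_max_right _ _
  have hpq : (p - q).natDegree ≤ n := (natDegree_sub_le _ _).trans (max_le hp hq)
  obtain ⟨t₀, ht₀⟩ : ∃ t₀ : ℂ, t₀ ∉ R.roots.toFinset := Infinite.exists_notMem_finset _
  have hRt : R.eval t₀ ≠ 0 := fun h => ht₀ (mem_roots_toFinset.mpr ⟨hR0, h⟩)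
  have hpt : p.eval t₀ ≠ 0 := fun h => hRt (by rw [hR, eval_mul, eval_mul, h, zero_mul, zero_mul])
  have hqt : q.eval t₀ ≠ 0 := fun h => hRt (by rw [hR, eval_mul, eval_mul, h, mul_zero, zero_mul])
  have hpqt : (p - q).eval t₀ ≠ 0 := fun h => hRt (by rw [hR, eval_mul, h, mul_zero])
  obtain ⟨P₁, hP₁⟩ : ∃ P₁, P₁ = taylor t₀ p := ⟨_, rfl⟩
  obtain ⟨Q₁, hQ₁⟩ : ∃ Q₁, Q₁ = taylor t₀ q := ⟨_, rfl⟩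
  have hPQ₁ : P₁ - Q₁ = taylor t₀ (p - q) := by rw [hP₁, hQ₁, map_sub]
  have hR₁ : P₁ * Q₁ * (P₁ - Q₁) = taylor t₀ R := by rw [hPQ₁, hP₁, hQ₁, hR, taylor_mul, taylor_mul]
  have hP₁deg : P₁.natDegree = p.natDegree := by rw [hP₁, natDegree_taylor]
  have hQ₁deg : Q₁.natDegree = q.natDegree := by rw [hQ₁, natDegree_taylor]
  have hPQ₁deg : (P₁ - Q₁).natDegree = (p - q).natDegree := by rw [hPQ₁, natDegree_taylor]
  have hcop₁ : IsCoprime P₁ Q₁ := by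
    rw [hP₁, hQ₁]; simpa using hcop.map (taylorAlgHom t₀).toRingHom
  have hev₁ : ∀ u, (P₁ * Q₁ * (P₁ - Q₁)).eval u = R.eval (u + t₀) := fun u => by
    rw [hR₁, taylor_eval]
  have hP₁c : P₁.coeff 0 = p.eval t₀ := by rw [hP₁, taylor_coeff_zero]
  have hQ₁c : Q₁.coeff 0 = q.eval t₀ := by rw [hQ₁, taylor_coeff_zero]
  have hPQ₁c : (P₁ - Q₁).coeff 0 = (p - q).eval t₀ := by rw [hPQ₁, taylor_coeff_zero]
  obtain ⟨P, hP⟩ : ∃ P, P = reflect n P₁ := ⟨_, rfl⟩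
  obtain ⟨Q, hQ⟩ : ∃ Q, Q = reflect n Q₁ := ⟨_, rfl⟩
  have hPQ : P - Q = reflect n (P₁ - Q₁) := by rw [hP, hQ, reflect_sub]
  have hPn : P.natDegree = n := hP ▸ natDegree_reflect_eq (hP₁deg.le.trans hp) (by rwa [hP₁c])
  have hQn : Q.natDegree = n := hQ ▸ natDegree_reflect_eq (hQ₁deg.le.trans hq) (by rwa [hQ₁c])
  have hPQn : (P - Q).natDegree = n :=
    hPQ ▸ natDegree_reflect_eq (hPQ₁deg.le.trans hpq) (by rwa [hPQ₁c])
  have hP0' : P ≠ 0 := fun h => by rw [h, natDegree_zero] at hPn; omega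
  have hQ0' : Q ≠ 0 := fun h => by rw [h, natDegree_zero] at hQn; omega
  have hPQ0' : P - Q ≠ 0 := fun h => by rw [h, natDegree_zero] at hPQn; omega
  have hR'0 : P * Q * (P - Q) ≠ 0 := mul_ne_zero (mul_ne_zero hP0' hQ0') hPQ0'
  have hev : ∀ u, u ≠ 0 → ((P * Q * (P - Q)).eval u = 0 ↔ R.eval (u⁻¹ + t₀) = 0) := by
    intro u hu
    rw [eval_mul, eval_mul, mul_eq_zero, mul_eq_zero, hPQ, hP, hQ,
      reflect_eval_eq_zero_iff (hP₁deg.le.trans hp) hu,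
      reflect_eval_eq_zero_iff (hQ₁deg.le.trans hq) hu,
      reflect_eval_eq_zero_iff (hPQ₁deg.le.trans hpq) hu, ← hev₁, eval_mul, eval_mul,
      mul_eq_zero, mul_eq_zero]
  have hev0 : (P * Q * (P - Q)).eval 0 = 0 := by   -- `0 = ∞'` is special (degree drop)
    rw [eval_mul, eval_mul, hPQ, hP, hQ, eval_zero_reflect, eval_zero_reflect, eval_zero_reflect]
    rcases hdrop with h | h | h
    · have h' : P₁.coeff n = 0 := coeff_eq_zero_of_natDegree_lt (by rw [hP₁deg]; exact h)
      rw [h', zero_mul, zero_mul]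
    · have h' : Q₁.coeff n = 0 := coeff_eq_zero_of_natDegree_lt (by rw [hQ₁deg]; exact h)
      rw [h', mul_zero, zero_mul]
    · have h' : (P₁ - Q₁).coeff n = 0 := coeff_eq_zero_of_natDegree_lt (by rw [hPQ₁deg]; exact h)
      rw [h', mul_zero]
  have hroots : (P * Q * (P - Q)).roots.toFinset =
      insert 0 (R.roots.toFinset.image (fun u => (u - t₀)⁻¹)) := by
    ext u
    rw [mem_roots_toFinset, Finset.mem_insert, Finset.mem_image]
    constructor
    · rintro ⟨-, hu⟩
      by_cases hu0 : u = 0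
      · exact Or.inl hu0
      · exact Or.inr ⟨u⁻¹ + t₀, mem_roots_toFinset.mpr ⟨hR0, (hev u hu0).mp hu⟩, by simp⟩
    · rintro (rfl | ⟨v, hv, rfl⟩)
      · exact ⟨hR'0, hev0⟩
      · obtain ⟨-, hvR⟩ := mem_roots_toFinset.mp hv
        have hvt : v - t₀ ≠ 0 := by
          intro h0; rw [sub_eq_zero] at h0; rw [h0] at hvR; exact hRt hvR
        refine ⟨hR'0, (hev _ (inv_ne_zero hvt)).mpr ?_⟩
        rw [inv_inv, sub_add_cancel]; exact hvR
  have hinj : Set.InjOn (fun u : ℂ => (u - t₀)⁻¹) ↑(R.roots.toFinset) := by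
    intro u _ v _ huv
    exact sub_left_inj.mp (inv_inj.mp huv)
  have h0notin : (0 : ℂ) ∉ R.roots.toFinset.image (fun u => (u - t₀)⁻¹) := by
    rw [Finset.mem_image]
    rintro ⟨v, hv, hv0⟩
    have h1 : v - t₀ = 0 := inv_eq_zero.mp hv0
    rw [sub_eq_zero] at h1; rw [h1] at hv; exact hRt (mem_roots_toFinset.mp hv).2
  have hcard' : (P * Q * (P - Q)).roots.toFinset.card = n + 2 := by
    rw [hroots, Finset.card_insert_of_notMem h0notin, Finset.card_image_of_injOn hinj, hcard]
  have hcop' : IsCoprime P Q := by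
    rw [Polynomial.isCoprime_iff_aeval_ne_zero_of_isAlgClosed ℂ ℂ]
    intro a
    simp only [coe_aeval_eq_eval]
    by_cases ha : a = 0
    · subst ha
      rw [hP, hQ, eval_zero_reflect, eval_zero_reflect]
      have hP₁0 : P₁ ≠ 0 := by rw [hP₁, Ne, taylor_eq_zero]; exact hp0
      have hQ₁0 : Q₁ ≠ 0 := by rw [hQ₁, Ne, taylor_eq_zero]; exact hq0
      rcases max_choice p.natDegree q.natDegree with hm | hm
      · left; have hl := leadingCoeff_ne_zero.mpr hP₁0
        rwa [leadingCoeff, hP₁deg, hm.symm.trans hmax] at hl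
      · right; have hl := leadingCoeff_ne_zero.mpr hQ₁0
        rwa [leadingCoeff, hQ₁deg, hm.symm.trans hmax] at hl
    · have h := (Polynomial.isCoprime_iff_aeval_ne_zero_of_isAlgClosed ℂ ℂ P₁ Q₁).mp hcop₁ a⁻¹
      simp only [coe_aeval_eq_eval] at h
      rcases h with h | h
      · left; rwa [Ne, hP, reflect_eval_eq_zero_iff (hP₁deg.le.trans hp) ha]
      · right; rwa [Ne, hQ, reflect_eval_eq_zero_iff (hQ₁deg.le.trans hq) ha]
  have hyt : y - t₀ ≠ 0 := fun h => by rw [sub_eq_zero] at h; rw [h] at hy; exact hRt hy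
  have hzt : z - t₀ ≠ 0 := fun h => by rw [sub_eq_zero] at h; rw [h] at hz; exact hRt hz
  have hwt : w - t₀ ≠ 0 := fun h => by rw [sub_eq_zero] at h; rw [h] at hw; exact hRt hw
  refine ⟨P, Q, 0, (y - t₀)⁻¹, (z - t₀)⁻¹, (w - t₀)⁻¹, hcop', hPn, hQn, hPQn, hcard', ?_, ?_, ?_⟩
  · have h0 : (0 : ℂ) ∉ ({(y - t₀)⁻¹, (z - t₀)⁻¹, (w - t₀)⁻¹} : Finset ℂ) := by
      simp only [Finset.mem_insert, Finset.mem_singleton, not_or]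
      exact ⟨(inv_ne_zero hyt).symm, (inv_ne_zero hzt).symm, (inv_ne_zero hwt).symm⟩
    have h3 : ({(y - t₀)⁻¹, (z - t₀)⁻¹, (w - t₀)⁻¹} : Finset ℂ).card = 3 := by
      rw [Finset.card_eq_three]
      exact ⟨_, _, _, fun h => hyz (sub_left_inj.mp (inv_inj.mp h)),
        fun h => hyw (sub_left_inj.mp (inv_inj.mp h)),
        fun h => hzw (sub_left_inj.mp (inv_inj.mp h)), rfl⟩
    rw [Finset.card_insert_of_notMem h0, h3]
  · intro u hu
    rw [hroots]
    simp only [Finset.mem_insert, Finset.mem_singleton] at hu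
    rcases hu with rfl | rfl | rfl | rfl
    · exact Finset.mem_insert_self _ _
    · exact Finset.mem_insert_of_mem
        (Finset.mem_image.mpr ⟨y, mem_roots_toFinset.mpr ⟨hR0, hy⟩, rfl⟩)
    · exact Finset.mem_insert_of_mem
        (Finset.mem_image.mpr ⟨z, mem_roots_toFinset.mpr ⟨hR0, hz⟩, rfl⟩)
    · exact Finset.mem_insert_of_mem
        (Finset.mem_image.mpr ⟨w, mem_roots_toFinset.mpr ⟨hR0, hw⟩, rfl⟩)
  · rw [sub_zero, sub_zero, inv_sub_inv hyt hzt, inv_sub_inv hwt hzt]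
    field_simp
    ring

end BelyiWitness

/-- **`HasBelyiWitness n t` ⇒ cross-ratio-`t` normal form of degree `n`** (for `t ∉ {0, 1}`): mark the
special points `y = t`, `z = 0`, `w = 1` of the witness and change chart
(`BelyiWitness.exists_crossRatio_of_inftyChart`); `CR(∞, t; 0, 1) = (t − 0)/(1 − 0) = t`. Converse of
`HasBelyiWitness.of_crossRatio` (`BelyiWitnessChart.lean`); invariance of the Belyi degree of the pointed
line under automorphisms of `ℙ¹`. [cite: Zapponi2009BelyiDegree, §1.1] [cite: Goldring2011, Thm 3.2] -/
theorem HasBelyiWitness.exists_crossRatio {n : ℕ} {t : ℂ} (h : HasBelyiWitness n t) (ht0 : t ≠ 0)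
    (ht1 : t ≠ 1) :
    ∃ (P Q : ℂ[X]) (x y z w : ℂ), IsCoprime P Q ∧ P.natDegree = n ∧ Q.natDegree = n ∧
      (P - Q).natDegree = n ∧ (P * Q * (P - Q)).roots.toFinset.card = n + 2 ∧
      ({x, y, z, w} : Finset ℂ).card = 4 ∧ {x, y, z, w} ⊆ (P * Q * (P - Q)).roots.toFinset ∧
      (w - x) * (y - z) = t * ((w - z) * (y - x)) := by
  obtain ⟨p, q, hcop, hmax, hdrop, hcard, h0, h1, ht⟩ := h
  obtain ⟨P, Q, x', y', z', w', hcop', hP, hQ, hPQ, hcard', h4, hsub, hcr⟩ :=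
    BelyiWitness.exists_crossRatio_of_inftyChart hcop hmax hdrop hcard ht0 ht1 zero_ne_one ht h0 h1
  refine ⟨P, Q, x', y', z', w', hcop', hP, hQ, hPQ, hcard', h4, hsub, ?_⟩
  rw [hcr, sub_zero, sub_zero, div_one]

/-- **The two inlined witness predicates agree**: for `t ∉ {0, 1}` and every `n`,
`HasBelyiWitness n t` (normal form of route ABC/BelyiDegreeSmooth, `∞` special) holds iff there is a
degree-`n` witness in the cross-ratio normal form of route ABC/BelyiSqueeze (`∞` not special, four marked
special points of cross-ratio `t`) — both render "`(ℙ¹; 0, 1, ∞, t)` carries a Belyi map of degree `n`"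
(equality case of Riemann–Hurwitz / Mason–Stothers), up to an automorphism of `ℙ¹`.
[cite: Zapponi2009BelyiDegree, §1.1] [cite: Goldring2011, Thm 3.2] -/
theorem hasBelyiWitness_iff_exists_crossRatio {n : ℕ} {t : ℂ} (ht0 : t ≠ 0) (ht1 : t ≠ 1) :
    HasBelyiWitness n t ↔
      ∃ (P Q : ℂ[X]) (x y z w : ℂ), IsCoprime P Q ∧ P.natDegree = n ∧ Q.natDegree = n ∧
        (P - Q).natDegree = n ∧ (P * Q * (P - Q)).roots.toFinset.card = n + 2 ∧
        ({x, y, z, w} : Finset ℂ).card = 4 ∧ {x, y, z, w} ⊆ (P * Q * (P - Q)).roots.toFinset ∧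
        (w - x) * (y - z) = t * ((w - z) * (y - x)) := by
  constructor
  · exact fun h => h.exists_crossRatio ht0 ht1
  · rintro ⟨P, Q, x, y, z, w, hcop, hP, hQ, hPQ, hcard, h4, hsub, hcr⟩
    exact HasBelyiWitness.of_crossRatio hcop hP hQ hPQ hcard h4 hsub hcr

/-- **Belyi's polynomial in the cross-ratio normal form**: every abc triple `a + b = c` has a degree-`c`
Belyi witness `φ = P/Q` (`deg P = deg Q = deg (P − Q) = c`, `c + 2` special points, `∞` not special) with
four marked special points of cross-ratio `a/c` — the content of the support item `BelyiWitnessLeC` of route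
ABC/BelyiSqueeze («deg_B(a/c) ≤ c», Belyĭ 1980), in Literature vocabulary. [cite: Belyi1980, §3] -/
theorem IsABCTriple.exists_crossRatio_witness {a b c : ℕ} (h : IsABCTriple a b c) :
    ∃ (P Q : ℂ[X]) (x y z w : ℂ), IsCoprime P Q ∧ P.natDegree = c ∧ Q.natDegree = c ∧
      (P - Q).natDegree = c ∧ (P * Q * (P - Q)).roots.toFinset.card = c + 2 ∧
      ({x, y, z, w} : Finset ℂ).card = 4 ∧ {x, y, z, w} ⊆ (P * Q * (P - Q)).roots.toFinset ∧
      (w - x) * (y - z) = ((a : ℂ) / (c : ℂ)) * ((w - z) * (y - x)) := by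
  have ha : 0 < a := h.1
  have hb : 0 < b := h.2.1
  have hc : a + b = c := h.2.2.1
  have hc0 : (c : ℂ) ≠ 0 := by exact_mod_cast (show c ≠ 0 by omega)
  have ht0 : (a : ℂ) / (c : ℂ) ≠ 0 := div_ne_zero (by exact_mod_cast ha.ne') hc0
  have ht1 : (a : ℂ) / (c : ℂ) ≠ 1 := by
    rw [Ne, div_eq_one_iff_eq hc0]
    exact_mod_cast (show a ≠ c by omega)
  exact h.hasBelyiWitness.exists_crossRatio ht0 ht1

end Literature.NumberTheory.DiophantineGeometry

end
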